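import Summits.BirchSwinnertonDyer.BirchSwinnertonDyer.Theorems.SmallImageMuTransferMuTransferX9StepTwoElement
import Literature.NumberTheory.GaloisRepresentations.ChebotarevOpenSubgroup
import Literature.NumberTheory.EllipticCurves.GaloisActionProofs
import HarnessLib

/-!
# Step 2 of the `μ`-transfer core (`stub_coreX9`, crux 19276 `MuTransferX9`): the coset
# representative on the governing subgroups of record, the open normal `Gal(ℚ̄/L')`, and the
# Chebotarev prime — STEP 2 end-to-end on the genuine objects

Cell `b2b-bsdres` (X9 prover lineage, GEN 43) serving the K6 route `SmallImageMuTransfer` of cell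
`bsd-smallim`. HONEST FRAMING: the cell deletes COMBINATION-SHAPED residual classes of the rank-≤1
BSD formula from PUBLISHED theorems only and TYPES the construction-shaped remainder; this is not
"finishing BSD"; class X9 stays TYPED at class level. `--supports` helper toward `stub_coreX9` of
stmt-BirchSwinnertonDyer-19276; books nothing, closes nothing; theorems only (no definition, no
named fact).

Sequel of `…X9StepTwoElement.lean` (p443158: MU-TRANSFER-PROOF §5 STEP 2, the element `g ∈ Γ_ℚ` fed
to Chebotarev — prescribed joint value `(x, x^*) ∈ M = (φ, ψ)(H)`, `ρ̄_{E,p}(g) = 1`, depth EXACTLY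
`n`). Here, for `p` odd, `E[p]` irreducible, `ρ̄_{E,p}` not onto:

* §4 the element on k6-c2's JOINT KERNEL `H = N_J(κ) ⊓ N_{J'}(κ.invTwist)` of `…X9StepOneSahJoint` /
  `…X9StepOneDual` (`N_J(κ) = ker(Γ_ℚ → Aut 𝒯_J(E, κ))`; `1 ≤ J ≤ pⁿ`, `J' ≤ pⁿ`), where both test
  classes project onto (`exists_mem_inf_ker_apply_eq_and_depth_of_ne_two`), and on the literal (F8)
  subgroup `G_{L₀} = ker ρ̄_{E,p} ⊓ Gal(ℚ̄/ℚ_n)` (`exists_mem_ker_inf_layerSubgroup_apply_eq_and_depth_of_ne_two`);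
* §5 the `ClassX9` forms (`p ≥ 5`);
* §6 (generic, any `TopRep`s): the OPEN NORMAL subgroup `N ≤ H ⊓ L` on which `φ`, `ψ` vanish —
  «`N = Gal(ℚ̄/L')`, `L' = L_M·ℚ_{n+1}`» without naming `L'`
  (`JointValue.exists_normal_isOpen_le_forall_apply_eq_zero`) — and the transport of membership /
  joint value along a coset `σ g⁻¹ ∈ N` (what "`Frob_𝔔 ≡ g (mod N)`" buys);
* §7 **`exists_isArithFrobAt_mem_inf_ker_apply_eq_and_depth_of_ne_two`: STEP 2 END-TO-END** — for
  every joint value `(x, x^*)` and every finite set `S` of places: an open normal `N ≤ H ⊓ Gal(ℚ̄/ℚ_{n+1})`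
  killed by `φ`, `ψ`, and a place `v ∉ S` unramified for `N` carrying an arithmetic Frobenius `Fr ∈ H`
  with `(φ Fr, ψ Fr) = (x, x^*)`, `ρ̄_{E,p}(Fr) = 1` (`E`-split), `Fr ∈ Gal(ℚ̄/ℚ_n) ∖ Gal(ℚ̄/ℚ_{n+1})`
  (`e_q = pⁿ = e`) — by k6-ty's Chebotarev for open normal subgroups
  (`exists_isArithFrobAt_mul_inv_mem_not_mem`, p432909). Downstream: koly's
  `exists_isAbsArithFrob_split_of_isArithFrobAt` / `twistExponent_eq_prime_pow_mul_of_depth`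
  (local data at `q`), then STEPS 3–4.

PARTITION (D-0054): X9 (A4) · X10∧¬Surj (A5) at `p = 3` — hypothesis-discharging helper toward
`stub_coreX9`; closes NONE.

References: J.-P. Serre, Invent. Math. 15 (1972) §2.4 Prop. 15, §2.6 [Serre1972]; C.-H. Sah, J.
Algebra 10 (1968) Prop. 2.7 (b) [Sah1968]; J.-P. Serre, *Local Fields*, VII §5 [SerreLocalFields1979];
J. Tate, *Global class field theory*, Cassels–Fröhlich (1967) VII §2.4 [TateGCFT1967]; L. Washington,
*Cyclotomic Fields*, §13.1–§13.2 [Washington1997]; HOME/koly/MU-TRANSFER-PROOF.md (F8), §5 STEP 2.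
-/

-- the summit and its single problem are both named `BirchSwinnertonDyer` (registry layout D-0017)
set_option linter.dupNamespace false

set_option autoImplicit false

noncomputable section

open Field WeierstrassCurve Literature.NumberTheory.EllipticCurves
  Literature.NumberTheory.GaloisRepresentations Function

namespace Summit.BirchSwinnertonDyer.BirchSwinnertonDyer.Rank1Residual

section Rat

variable (W : WeierstrassCurve ℚ) [W.IsElliptic] (p : ℕ) [Fact p.Prime] (κ κ' : ZpExtension ℚ p)

/-! ### §4 The two governing subgroups of record: k6-c2's joint kernel `N_J(κ) ⊓ N_{J'}(κ⁻¹)` and `G_{L₀}` -/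

/-- **STEP 2's coset representative on k6-c2's joint kernel** `H = N_J(κ) ⊓ N_{J'}(κ.invTwist)`
(`N_J(κ) = ker(Γ_ℚ → Aut 𝒯_J(E, κ))`, the subgroup of `…X9StepOneSahJoint` / `…X9StepOneDual` on
which both test classes `h`, `h^*` live), `1 ≤ J ≤ p^n`, `J' ≤ p^n`, `p` odd, `E[p]` irreducible,
`ρ̄_{E,p}` not onto: every joint value `w ∈ M = (φ, ψ)(H)` is `(φ σ, ψ σ)` for some `σ ∈ H` with
`ρ̄_{E,p}(σ) = 1`, `σ ∈ Gal(ℚ̄/ℚ_n)`, `σ ∉ Gal(ℚ̄/ℚ_{n+1})`. [cite: Serre1972, §2.4 Prop. 15 and §2.6]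
[cite: Sah1968, Prop. 2.7 (b)] [cite: Washington1997, §13.1–§13.2] -/
theorem exists_mem_inf_ker_apply_eq_and_depth_of_ne_two (hp2 : p ≠ 2)
    (hirr : W.HasIrreducibleModPGaloisRep p) (hns : ¬ W.HasSurjectiveModNGaloisRep p)
    {J J' n : ℕ} (hJ0 : 0 < J) (hJ : J ≤ p ^ n) (hJ' : J' ≤ p ^ n)
    (φ : contOneCocycles (W.modPTwist p κ J).toTopRep)
    (ψ : contOneCocycles (W.modPTwist p κ.invTwist J').toTopRep)
    {w : (W.modPTwist p κ J).toTopRep × (W.modPTwist p κ.invTwist J').toTopRep}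
    (hw : w ∈ contOneCocycles.jointValueSubgroup φ ψ
      ((κ.twistModPRepresentation (W.torsionGaloisModule (p : ℤ))
          (fun P : geomTorsion W (p : ℤ) => AddSubgroup.torsionBy.nsmul P) J).ker ⊓
        (κ.invTwist.twistModPRepresentation (W.torsionGaloisModule (p : ℤ))
          (fun P : geomTorsion W (p : ℤ) => AddSubgroup.torsionBy.nsmul P) J').ker)
      (fun _ hτ x => κ.toTopRep_ρ_apply_eq_self_of_mem_ker (W.torsionGaloisModule (p : ℤ)) _ J
        (Subgroup.mem_inf.mp hτ).1 x)
      (fun _ hτ y => κ.invTwist.toTopRep_ρ_apply_eq_self_of_mem_ker (W.torsionGaloisModule (p : ℤ))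
        _ J' (Subgroup.mem_inf.mp hτ).2 y)) :
    ∃ σ ∈ (κ.twistModPRepresentation (W.torsionGaloisModule (p : ℤ))
          (fun P : geomTorsion W (p : ℤ) => AddSubgroup.torsionBy.nsmul P) J).ker ⊓
        (κ.invTwist.twistModPRepresentation (W.torsionGaloisModule (p : ℤ))
          (fun P : geomTorsion W (p : ℤ) => AddSubgroup.torsionBy.nsmul P) J').ker,
      φ.1 σ = w.1 ∧ ψ.1 σ = w.2 ∧ galoisRepTorsion W p σ = 1 ∧
        σ ∈ κ.layerSubgroup n ∧ σ ∉ κ.layerSubgroup (n + 1) := by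
  refine exists_mem_apply_eq_and_depth_of_ne_two W p κ κ.invTwist hp2 hirr hns
    (ZpExtension.kerSubgroup_unitTwist κ (-1)) J J' n φ ψ _ _ _ (le_inf ?_ ?_)
    (inf_le_left.trans (ker_twistModPRepresentation_le_ker W p κ hJ0)) hw
  · exact ker_inf_layerSubgroup_le_ker_twistModPRepresentation W p κ hJ
  · rw [← ZpExtension.layerSubgroup_invTwist κ n]
    exact ker_inf_layerSubgroup_le_ker_twistModPRepresentation W p κ.invTwist hJ'

/-- **STEP 2's coset representative on `G_{L₀} = ker ρ̄_{E,p} ⊓ Gal(ℚ̄/ℚ_n)` itself** (the literal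
(F8) subgroup, GEN 42's currency; `J, J' ≤ p^n`; `p` odd, `E[p]` irreducible, `ρ̄_{E,p}` not onto):
every joint value of `(φ, ψ)` on `G_{L₀}` is `(φ σ, ψ σ)` for some `σ ∈ G_{L₀}` of depth exactly `n`
(`σ ∉ Gal(ℚ̄/ℚ_{n+1})`), `ρ̄_{E,p}(σ) = 1`. [cite: Serre1972, §2.4 Prop. 15 and §2.6]
[cite: Sah1968, Prop. 2.7 (b)] [cite: Washington1997, §13.1–§13.2] -/
theorem exists_mem_ker_inf_layerSubgroup_apply_eq_and_depth_of_ne_two (hp2 : p ≠ 2)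
    (hirr : W.HasIrreducibleModPGaloisRep p) (hns : ¬ W.HasSurjectiveModNGaloisRep p)
    {J J' n : ℕ} (hJ : J ≤ p ^ n) (hJ' : J' ≤ p ^ n)
    (φ : contOneCocycles (W.modPTwist p κ J).toTopRep)
    (ψ : contOneCocycles (W.modPTwist p κ.invTwist J').toTopRep)
    {w : (W.modPTwist p κ J).toTopRep × (W.modPTwist p κ.invTwist J').toTopRep}
    (hw : w ∈ contOneCocycles.jointValueSubgroup φ ψ
      ((galoisRepTorsion W p).ker ⊓ κ.layerSubgroup n)
      (fun _ hτ x => toTopRep_ρ_apply_eq_self_of_mem_ker_inf_layerSubgroup W p κ hJ hτ x)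
      (fun _ hτ y => toTopRep_ρ_apply_eq_self_of_mem_ker_inf_layerSubgroup W p κ.invTwist hJ'
        ((ZpExtension.layerSubgroup_invTwist κ n).symm ▸ hτ) y)) :
    ∃ σ ∈ (galoisRepTorsion W p).ker ⊓ κ.layerSubgroup n,
      φ.1 σ = w.1 ∧ ψ.1 σ = w.2 ∧ galoisRepTorsion W p σ = 1 ∧
        σ ∈ κ.layerSubgroup n ∧ σ ∉ κ.layerSubgroup (n + 1) :=
  exists_mem_apply_eq_and_depth_of_ne_two W p κ κ.invTwist hp2 hirr hns
    (ZpExtension.kerSubgroup_unitTwist κ (-1)) J J' n φ ψ _ _ _ le_rfl inf_le_left hw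

/-! ### §5 Class X9 -/

variable [W.IsGloballyMinimal]

/-- **On class X9: STEP 2's coset representative with prescribed `κ`-value** (any normal `H`
acting trivially on `𝒯_J(E, κ)` and `𝒯_{J'}(E, κ')`, `ker κ' = ker κ`).
[cite: Serre1972, §2.4 Prop. 15 and §2.6] [cite: Sah1968, Prop. 2.7 (b)] -/
theorem ClassX9.exists_mem_apply_eq_and_apply_eq (h : ClassX9 W p)
    (hker : κ'.kerSubgroup = κ.kerSubgroup) (J J' : ℕ)
    (φ : contOneCocycles (W.modPTwist p κ J).toTopRep)
    (ψ : contOneCocycles (W.modPTwist p κ' J').toTopRep)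
    (H : Subgroup (absoluteGaloisGroup ℚ)) [H.Normal]
    (hX : ∀ τ ∈ H, ∀ x : (W.modPTwist p κ J).toTopRep, (W.modPTwist p κ J).toTopRep.ρ τ x = x)
    (hY : ∀ τ ∈ H, ∀ y : (W.modPTwist p κ' J').toTopRep, (W.modPTwist p κ' J').toTopRep.ρ τ y = y)
    {σ₁ : absoluteGaloisGroup ℚ} (hσ₁ : σ₁ ∈ H)
    {w : (W.modPTwist p κ J).toTopRep × (W.modPTwist p κ' J').toTopRep}
    (hw : w ∈ contOneCocycles.jointValueSubgroup φ ψ H hX hY) :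
    ∃ σ ∈ H, κ σ = κ σ₁ ∧ φ.1 σ = w.1 ∧ ψ.1 σ = w.2 :=
  exists_mem_apply_eq_and_apply_eq_of_ne_two W p κ κ' (by have := h.2.1; omega) h.2.2.2.2.1
    h.2.2.2.2.2 hker J J' φ ψ H hX hY hσ₁ hw

/-- **On class X9: STEP 2's Chebotarev coset representative on the joint kernel
`N_J(κ) ⊓ N_{J'}(κ⁻¹)`** (`1 ≤ J ≤ p^n`, `J' ≤ p^n`): prescribed joint value, `ρ̄_{E,p}(σ) = 1`, depth
exactly `n`. [cite: Serre1972, §2.4 Prop. 15 and §2.6] [cite: Sah1968, Prop. 2.7 (b)]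
[cite: Washington1997, §13.1–§13.2] -/
theorem ClassX9.exists_mem_inf_ker_apply_eq_and_depth (h : ClassX9 W p) {J J' n : ℕ}
    (hJ0 : 0 < J) (hJ : J ≤ p ^ n) (hJ' : J' ≤ p ^ n)
    (φ : contOneCocycles (W.modPTwist p κ J).toTopRep)
    (ψ : contOneCocycles (W.modPTwist p κ.invTwist J').toTopRep)
    {w : (W.modPTwist p κ J).toTopRep × (W.modPTwist p κ.invTwist J').toTopRep}
    (hw : w ∈ contOneCocycles.jointValueSubgroup φ ψ
      ((κ.twistModPRepresentation (W.torsionGaloisModule (p : ℤ))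
          (fun P : geomTorsion W (p : ℤ) => AddSubgroup.torsionBy.nsmul P) J).ker ⊓
        (κ.invTwist.twistModPRepresentation (W.torsionGaloisModule (p : ℤ))
          (fun P : geomTorsion W (p : ℤ) => AddSubgroup.torsionBy.nsmul P) J').ker)
      (fun _ hτ x => κ.toTopRep_ρ_apply_eq_self_of_mem_ker (W.torsionGaloisModule (p : ℤ)) _ J
        (Subgroup.mem_inf.mp hτ).1 x)
      (fun _ hτ y => κ.invTwist.toTopRep_ρ_apply_eq_self_of_mem_ker (W.torsionGaloisModule (p : ℤ))
        _ J' (Subgroup.mem_inf.mp hτ).2 y)) :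
    ∃ σ ∈ (κ.twistModPRepresentation (W.torsionGaloisModule (p : ℤ))
          (fun P : geomTorsion W (p : ℤ) => AddSubgroup.torsionBy.nsmul P) J).ker ⊓
        (κ.invTwist.twistModPRepresentation (W.torsionGaloisModule (p : ℤ))
          (fun P : geomTorsion W (p : ℤ) => AddSubgroup.torsionBy.nsmul P) J').ker,
      φ.1 σ = w.1 ∧ ψ.1 σ = w.2 ∧ galoisRepTorsion W p σ = 1 ∧
        σ ∈ κ.layerSubgroup n ∧ σ ∉ κ.layerSubgroup (n + 1) :=
  exists_mem_inf_ker_apply_eq_and_depth_of_ne_two W p κ (by have := h.2.1; omega) h.2.2.2.2.1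
    h.2.2.2.2.2 hJ0 hJ hJ' φ ψ hw

/-- **On class X9: STEP 2's Chebotarev coset representative on `G_{L₀} = ker ρ̄ ⊓ Gal(ℚ̄/ℚ_n)`**
(`J, J' ≤ p^n`). [cite: Serre1972, §2.4 Prop. 15 and §2.6] [cite: Sah1968, Prop. 2.7 (b)]
[cite: Washington1997, §13.1–§13.2] -/
theorem ClassX9.exists_mem_ker_inf_layerSubgroup_apply_eq_and_depth (h : ClassX9 W p)
    {J J' n : ℕ} (hJ : J ≤ p ^ n) (hJ' : J' ≤ p ^ n)
    (φ : contOneCocycles (W.modPTwist p κ J).toTopRep)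
    (ψ : contOneCocycles (W.modPTwist p κ.invTwist J').toTopRep)
    {w : (W.modPTwist p κ J).toTopRep × (W.modPTwist p κ.invTwist J').toTopRep}
    (hw : w ∈ contOneCocycles.jointValueSubgroup φ ψ
      ((galoisRepTorsion W p).ker ⊓ κ.layerSubgroup n)
      (fun _ hτ x => toTopRep_ρ_apply_eq_self_of_mem_ker_inf_layerSubgroup W p κ hJ hτ x)
      (fun _ hτ y => toTopRep_ρ_apply_eq_self_of_mem_ker_inf_layerSubgroup W p κ.invTwist hJ'
        ((ZpExtension.layerSubgroup_invTwist κ n).symm ▸ hτ) y)) :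
    ∃ σ ∈ (galoisRepTorsion W p).ker ⊓ κ.layerSubgroup n,
      φ.1 σ = w.1 ∧ ψ.1 σ = w.2 ∧ galoisRepTorsion W p σ = 1 ∧
        σ ∈ κ.layerSubgroup n ∧ σ ∉ κ.layerSubgroup (n + 1) :=
  exists_mem_ker_inf_layerSubgroup_apply_eq_and_depth_of_ne_two W p κ (by have := h.2.1; omega)
    h.2.2.2.2.1 h.2.2.2.2.2 hJ hJ' φ ψ hw

end Rat

/-! ### §6 Generic: an open normal subgroup inside the joint kernel (the «`Gal(ℚ̄/L')`» of STEP 2) -/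

namespace JointValue

universe u v

variable {R : Type u} [Ring R] [TopologicalSpace R]
variable {G : Type v} [Group G] [TopologicalSpace G]
variable {X Y : TopRep.{v} R G}

/-- **The subgroup `Gal(Ḡ/L')` of STEP 2 without naming `L'`.** For `H ⊴ G` open acting trivially on
`X` and `Y`, continuous cocycles `φ`, `ψ` (values in modules whose `{0}` is open, e.g. discrete) and
an auxiliary open normal `L` (the next layer `Gal(ℚ̄/ℚ_{n+1})`): the set
`{σ ∈ H ∩ L : φ σ = 0, ψ σ = 0}` is an OPEN NORMAL subgroup `N ≤ H ⊓ L` of `G` on which `φ` and `ψ`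
vanish (`φ|_H`, `ψ|_H` are `G`-equivariant homomorphisms). [cite: SerreLocalFields1979, VII §5 Prop. 3] -/
theorem exists_normal_isOpen_le_forall_apply_eq_zero (φ : contOneCocycles X)
    (ψ : contOneCocycles Y) (H : Subgroup G) [H.Normal] (hX : ∀ τ ∈ H, ∀ x : X, X.ρ τ x = x)
    (hY : ∀ τ ∈ H, ∀ y : Y, Y.ρ τ y = y) (hHo : IsOpen (H : Set G)) (L : Subgroup G) [L.Normal]
    (hLo : IsOpen (L : Set G)) (h0X : IsOpen ({0} : Set X)) (h0Y : IsOpen ({0} : Set Y)) :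
    ∃ N : Subgroup G, N.Normal ∧ IsOpen (N : Set G) ∧ N ≤ H ∧ N ≤ L ∧
      (∀ σ ∈ N, φ.1 σ = 0) ∧ (∀ σ ∈ N, ψ.1 σ = 0) := by
  refine ⟨{ carrier := ((H : Set G) ∩ (L : Set G)) ∩ ((⇑φ.1 ⁻¹' {0}) ∩ (⇑ψ.1 ⁻¹' {0}))
            one_mem' := ⟨⟨H.one_mem, L.one_mem⟩, contOneCocycles.apply_one φ,
              contOneCocycles.apply_one ψ⟩
            mul_mem' := ?_, inv_mem' := ?_ }, ?_, ?_, ?_, ?_, ?_, ?_⟩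
  · rintro a b ⟨⟨haH, haL⟩, haφ, haψ⟩ ⟨⟨hbH, hbL⟩, hbφ, hbψ⟩
    simp only [Set.mem_inter_iff, Set.mem_preimage, Set.mem_singleton_iff, SetLike.mem_coe] at *
    refine ⟨⟨H.mul_mem haH hbH, L.mul_mem haL hbL⟩, ?_, ?_⟩
    · rw [contOneCocycles.apply_mul_of_fixed φ (hX a haH), haφ, hbφ, add_zero]
    · rw [contOneCocycles.apply_mul_of_fixed ψ (hY a haH), haψ, hbψ, add_zero]
  · rintro a ⟨⟨haH, haL⟩, haφ, haψ⟩
    simp only [Set.mem_inter_iff, Set.mem_preimage, Set.mem_singleton_iff, SetLike.mem_coe] at *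
    refine ⟨⟨H.inv_mem haH, L.inv_mem haL⟩, ?_, ?_⟩
    · rw [contOneCocycles.apply_inv_of_fixed φ (hX a haH), haφ, neg_zero]
    · rw [contOneCocycles.apply_inv_of_fixed ψ (hY a haH), haψ, neg_zero]
  · refine ⟨fun σ hσ g => ?_⟩
    obtain ⟨⟨hσH, hσL⟩, hσφ, hσψ⟩ := hσ
    simp only [Set.mem_preimage, Set.mem_singleton_iff, SetLike.mem_coe] at hσH hσL hσφ hσψ
    refine ⟨⟨Subgroup.Normal.conj_mem inferInstance σ hσH g,
      Subgroup.Normal.conj_mem inferInstance σ hσL g⟩, ?_, ?_⟩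
    · show φ.1 (g * σ * g⁻¹) ∈ ({0} : Set X)
      rw [Set.mem_singleton_iff, contOneCocycles.apply_conj_of_fixed φ (hX σ hσH) g, hσφ, map_zero]
    · show ψ.1 (g * σ * g⁻¹) ∈ ({0} : Set Y)
      rw [Set.mem_singleton_iff, contOneCocycles.apply_conj_of_fixed ψ (hY σ hσH) g, hσψ, map_zero]
  · exact (hHo.inter hLo).inter ((h0X.preimage φ.1.continuous).inter (h0Y.preimage ψ.1.continuous))
  · exact fun σ hσ => hσ.1.1
  · exact fun σ hσ => hσ.1.2
  · exact fun σ hσ => hσ.2.1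
  · exact fun σ hσ => hσ.2.2

/-- **Transport along a coset of `N`**: if `N ≤ H` with `φ|_N = 0` and `σ g⁻¹ ∈ N` for some
`g ∈ H`, then `σ ∈ H` and `φ σ = φ g` (Frobenius in the coset of `g` has the joint value of `g`).
[cite: SerreLocalFields1979, VII §5] -/
theorem mem_and_apply_eq_of_mul_inv_mem (φ : contOneCocycles X) (H : Subgroup G)
    (hX : ∀ τ ∈ H, ∀ x : X, X.ρ τ x = x) {N : Subgroup G} (hNH : N ≤ H)
    (hNφ : ∀ σ ∈ N, φ.1 σ = 0) {g σ : G} (hg : g ∈ H) (hσ : σ * g⁻¹ ∈ N) :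
    σ ∈ H ∧ φ.1 σ = φ.1 g := by
  have hσ' : σ = σ * g⁻¹ * g := by rw [inv_mul_cancel_right]
  refine ⟨?_, ?_⟩
  · rw [hσ']
    exact H.mul_mem (hNH hσ) hg
  · rw [hσ', contOneCocycles.apply_mul_of_fixed φ (hX _ (hNH hσ)), hNφ _ hσ, zero_add]

omit [TopologicalSpace G] in
/-- Membership in a subgroup `L ≥ N` is constant on cosets of `N`. [folklore] -/
theorem mem_iff_mem_of_mul_inv_mem {N L : Subgroup G} (hNL : N ≤ L) {g σ : G}
    (hσ : σ * g⁻¹ ∈ N) : σ ∈ L ↔ g ∈ L := by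
  constructor
  · intro h
    have := L.mul_mem (L.inv_mem (hNL hσ)) h
    rwa [mul_inv_rev, inv_inv, inv_mul_cancel_right] at this
  · intro h
    have := L.mul_mem (hNL hσ) h
    rwa [inv_mul_cancel_right] at this

end JointValue

/-! ### §7 Over `ℚ`: STEP 2 end-to-end — a Chebotarev prime outside `S` with the prescribed Frobenius -/

section RatChebotarev

open scoped NumberField

open IsDedekindDomain NumberField

variable (W : WeierstrassCurve ℚ) [W.IsElliptic] (p : ℕ) [Fact p.Prime] (κ : ZpExtension ℚ p)

/-- **MU-TRANSFER-PROOF §5 STEP 2 on the genuine objects, end-to-end** (`p` odd, `E[p]` irreducible,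
`ρ̄_{E,p}` not onto; `H = N_J(κ) ⊓ N_{J'}(κ⁻¹)` k6-c2's joint kernel, `1 ≤ J ≤ pⁿ`, `J' ≤ pⁿ`).
For every joint value `w = (x, x^*) ∈ M = (φ, ψ)(H)` and every finite set `S` of places of `ℚ` there
are an open normal subgroup `N ≤ H ⊓ Gal(ℚ̄/ℚ_{n+1})` killed by `φ` and `ψ` («`N = Gal(ℚ̄/L')`,
`L' = L_M·ℚ_{n+1} ⊇ L₀(μ_{p^{m₀+1}})`») and a place `v ∉ S` UNRAMIFIED for `N` with an arithmetic
Frobenius `Fr` above it such that `Fr ∈ H`, `(φ Fr, ψ Fr) = (x, x^*)`, `ρ̄_{E,p}(Fr) = 1` (`v` is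
`E`-split), `Fr ∈ Gal(ℚ̄/ℚ_n) ∖ Gal(ℚ̄/ℚ_{n+1})` (depth exactly `n`: `e_q = pⁿ = e`). Element: §4;
primes: Chebotarev for open normal subgroups (tree `exists_isArithFrobAt_mul_inv_mem_not_mem`).
[cite: Serre1972, §2.4 Prop. 15 and §2.6] [cite: Sah1968, Prop. 2.7 (b)]
[cite: TateGCFT1967, §2.4 (Tchebotarev density theorem) with Prop. 2.3]
[cite: Washington1997, §13.1–§13.2] -/
theorem exists_isArithFrobAt_mem_inf_ker_apply_eq_and_depth_of_ne_two (hp2 : p ≠ 2)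
    (hirr : W.HasIrreducibleModPGaloisRep p) (hns : ¬ W.HasSurjectiveModNGaloisRep p)
    {J J' n : ℕ} (hJ0 : 0 < J) (hJ : J ≤ p ^ n) (hJ' : J' ≤ p ^ n)
    (φ : contOneCocycles (W.modPTwist p κ J).toTopRep)
    (ψ : contOneCocycles (W.modPTwist p κ.invTwist J').toTopRep)
    {w : (W.modPTwist p κ J).toTopRep × (W.modPTwist p κ.invTwist J').toTopRep}
    (hw : w ∈ contOneCocycles.jointValueSubgroup φ ψ
      ((κ.twistModPRepresentation (W.torsionGaloisModule (p : ℤ))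
          (fun P : geomTorsion W (p : ℤ) => AddSubgroup.torsionBy.nsmul P) J).ker ⊓
        (κ.invTwist.twistModPRepresentation (W.torsionGaloisModule (p : ℤ))
          (fun P : geomTorsion W (p : ℤ) => AddSubgroup.torsionBy.nsmul P) J').ker)
      (fun _ hτ x => κ.toTopRep_ρ_apply_eq_self_of_mem_ker (W.torsionGaloisModule (p : ℤ)) _ J
        (Subgroup.mem_inf.mp hτ).1 x)
      (fun _ hτ y => κ.invTwist.toTopRep_ρ_apply_eq_self_of_mem_ker (W.torsionGaloisModule (p : ℤ))
        _ J' (Subgroup.mem_inf.mp hτ).2 y))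
    (S : Set (HeightOneSpectrum (𝓞 ℚ))) (hS : S.Finite) :
    ∃ N : Subgroup (absoluteGaloisGroup ℚ), N.Normal ∧ IsOpen (N : Set (absoluteGaloisGroup ℚ)) ∧
      N ≤ (κ.twistModPRepresentation (W.torsionGaloisModule (p : ℤ))
          (fun P : geomTorsion W (p : ℤ) => AddSubgroup.torsionBy.nsmul P) J).ker ⊓
        (κ.invTwist.twistModPRepresentation (W.torsionGaloisModule (p : ℤ))
          (fun P : geomTorsion W (p : ℤ) => AddSubgroup.torsionBy.nsmul P) J').ker ∧
      N ≤ κ.layerSubgroup (n + 1) ∧ (∀ σ ∈ N, φ.1 σ = 0) ∧ (∀ σ ∈ N, ψ.1 σ = 0) ∧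
      ∃ v ∉ S, SubgroupIsUnramifiedAt ℚ N v ∧
        ∃ 𝔓 ∈ v.primesAbove, ∃ Fr : absoluteGaloisGroup ℚ, IsArithFrobAt (𝓞 ℚ) Fr 𝔓 ∧
          Fr ∈ (κ.twistModPRepresentation (W.torsionGaloisModule (p : ℤ))
              (fun P : geomTorsion W (p : ℤ) => AddSubgroup.torsionBy.nsmul P) J).ker ⊓
            (κ.invTwist.twistModPRepresentation (W.torsionGaloisModule (p : ℤ))
              (fun P : geomTorsion W (p : ℤ) => AddSubgroup.torsionBy.nsmul P) J').ker ∧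
          φ.1 Fr = w.1 ∧ ψ.1 Fr = w.2 ∧ galoisRepTorsion W p Fr = 1 ∧
          Fr ∈ κ.layerSubgroup n ∧ Fr ∉ κ.layerSubgroup (n + 1) := by
  have hp : p.Prime := Fact.out
  haveI : Finite (geomTorsion W (p : ℤ)) :=
    WeierstrassCurve.finite_torsionPoints_holds W (AlgebraicClosure ℚ) (by exact_mod_cast hp.ne_zero)
  -- the element `g` of §4
  obtain ⟨g, hgH, hφg, hψg, -, hgn, hgn1⟩ :=
    exists_mem_inf_ker_apply_eq_and_depth_of_ne_two W p κ hp2 hirr hns hJ0 hJ hJ' φ ψ hw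
  -- the open normal subgroup `N = Gal(ℚ̄/L')`
  have hHo : IsOpen (((κ.twistModPRepresentation (W.torsionGaloisModule (p : ℤ))
          (fun P : geomTorsion W (p : ℤ) => AddSubgroup.torsionBy.nsmul P) J).ker ⊓
        (κ.invTwist.twistModPRepresentation (W.torsionGaloisModule (p : ℤ))
          (fun P : geomTorsion W (p : ℤ) => AddSubgroup.torsionBy.nsmul P) J').ker :
        Subgroup (absoluteGaloisGroup ℚ)) : Set (absoluteGaloisGroup ℚ)) :=
    (κ.isOpen_ker_twistModPRepresentation (W.torsionGaloisModule (p : ℤ)) _ J).inter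
      (κ.invTwist.isOpen_ker_twistModPRepresentation (W.torsionGaloisModule (p : ℤ)) _ J')
  obtain ⟨N, hNn, hNo, hNH, hNL, hNφ, hNψ⟩ :=
    JointValue.exists_normal_isOpen_le_forall_apply_eq_zero φ ψ _
      (fun _ hτ x => κ.toTopRep_ρ_apply_eq_self_of_mem_ker (W.torsionGaloisModule (p : ℤ)) _ J
        (Subgroup.mem_inf.mp hτ).1 x)
      (fun _ hτ y => κ.invTwist.toTopRep_ρ_apply_eq_self_of_mem_ker (W.torsionGaloisModule (p : ℤ))
        _ J' (Subgroup.mem_inf.mp hτ).2 y)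
      hHo (κ.layerSubgroup (n + 1)) (κ.isOpen_layerSubgroup (n + 1)) (isOpen_discrete _)
      (isOpen_discrete _)
  haveI := hNn
  -- Chebotarev in `ℚ̄^N / ℚ` at the class of `g`
  obtain ⟨v, hvS, hunr, 𝔓, h𝔓, Fr, hFr, hFrg⟩ :=
    exists_isArithFrobAt_mul_inv_mem_not_mem ℚ N hNo g S hS
  obtain ⟨hFrH, hφFr⟩ := JointValue.mem_and_apply_eq_of_mul_inv_mem φ _
    (fun _ hτ x => κ.toTopRep_ρ_apply_eq_self_of_mem_ker (W.torsionGaloisModule (p : ℤ)) _ J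
      (Subgroup.mem_inf.mp hτ).1 x) hNH hNφ hgH hFrg
  obtain ⟨-, hψFr⟩ := JointValue.mem_and_apply_eq_of_mul_inv_mem ψ _
    (fun _ hτ y => κ.invTwist.toTopRep_ρ_apply_eq_self_of_mem_ker (W.torsionGaloisModule (p : ℤ))
      _ J' (Subgroup.mem_inf.mp hτ).2 y) hNH hNψ hgH hFrg
  refine ⟨N, hNn, hNo, hNH, hNL, hNφ, hNψ, v, hvS, hunr, 𝔓, h𝔓, Fr, hFr, hFrH, hφFr.trans hφg,
    hψFr.trans hψg, ?_, ?_, ?_⟩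
  · exact MonoidHom.mem_ker.mp
      ((inf_le_left.trans (ker_twistModPRepresentation_le_ker W p κ hJ0)) hFrH)
  · exact (JointValue.mem_iff_mem_of_mul_inv_mem
      (hNL.trans (κ.layerSubgroup_antitone (Nat.le_succ n))) hFrg).mpr hgn
  · exact fun h => hgn1 ((JointValue.mem_iff_mem_of_mul_inv_mem hNL hFrg).mp h)

end RatChebotarev

end Summit.BirchSwinnertonDyer.BirchSwinnertonDyer.Rank1Residual

end
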